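import Summits.AtomisticToContinuum.BoseEinsteinCondensation.Theorems.BECHusimiAmplitudeGasLaplaceCapUnionGaussIII

/-!
# Bargmann orthogonality of Gaussian monomials on `ι → ℂ`

Helper file for route `BECHusimiAmplitudeGas`, support item `HusimiConcentration`
(stmt-AtomisticToContinuum-11994): the exact Segal–Bargmann computation behind the "exact identity"
of the route thesis. With the Gaussian weight `e^{-q(c)}`, `q(c) = ∑ᵢ ‖cᵢ‖²`, on `ι → ℂ`
(product Lebesgue measure) and, for `f : Fin m → ι`, the occupation numbers
`αᵢ(f) = #{j | f j = i}`:

* `integral_gauss_conj_pow_mul_pow`: `∫_ℂ e^{-|z|²} conj(z)^m zⁿ = π m! δ_{mn}`;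
* `integral_gauss_prod_conj_mul_prod`: `∫ e^{-q} (∏ⱼ conj c_{f j}) (∏ⱼ c_{g j}) dc =
  [α(f) = α(g)] π^{|ι|} ∏ᵢ αᵢ(f)!` (orthogonality of monomials, Bargmann 1961);
* `exists_perm_comp_eq_of_occ_eq`: equal occupation numbers ⇒ `g = f ∘ σ` for a permutation `σ`;
* `sum_perm_comp`: `∑_σ G(f ∘ σ) = (∏ᵢ αᵢ(f)!) ∑_{g : α(g) = α(f)} G(g)` (orbit–stabiliser count,
  Mathlib's `DomMulAct.stabilizer_card`);
* `sum_conj_mul_pairing`: for a SYMMETRIC coefficient family `A` (`A (f ∘ σ) = A f`),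
  `∑_g conj(A g) ∫ e^{-q} conj(c)^f c^g = π^{|ι|} m! conj(A f)`.

The two Husimi identities built from these are in the companion file
`BECHusimiAmplitudeGasHusimiConcentrationBargmannII.lean`.
-/

noncomputable section

open MeasureTheory Set
open scoped ENNReal NNReal ComplexConjugate

namespace Summit.AtomisticToContinuum.BoseEinsteinCondensation.Theorems.BargmannIdentity

open Summit.AtomisticToContinuum.BoseEinsteinCondensation.Theorems.LaplaceCapUnion

variable {ι : Type*} [Fintype ι] [DecidableEq ι]

/-! ### One complex variable -/

omit [Fintype ι] [DecidableEq ι] in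
/-- `∫_ℂ e^{-|z|²} |z|^{2n} dA = π n!` (polar coordinates and the Gamma integral). [folklore] -/
theorem integral_exp_neg_norm_sq_mul_norm_pow (n : ℕ) :
    ∫ z : ℂ, Real.exp (-‖z‖ ^ 2) * ‖z‖ ^ (2 * n) = Real.pi * n.factorial := by
  have hq : (-2 : ℝ) < ((2 * n : ℕ) : ℝ) := by
    have : (0 : ℝ) ≤ ((2 * n : ℕ) : ℝ) := by positivity
    linarith
  have h := Complex.integral_rpow_mul_exp_neg_rpow (p := 2) (q := ((2 * n : ℕ) : ℝ)) (by norm_num) hq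
  have h2 : ((2 * n : ℕ) : ℝ) + 2 = 2 * ((n : ℝ) + 1) := by push_cast; ring
  rw [h2, mul_div_cancel_left₀ _ (two_ne_zero), mul_div_cancel_left₀ _ (two_ne_zero),
    Real.Gamma_nat_eq_factorial] at h
  rw [← h]
  refine integral_congr_ae (Filter.Eventually.of_forall fun z => ?_)
  simp only [Real.rpow_natCast]
  rw [show (‖z‖ : ℝ) ^ (2 : ℝ) = ‖z‖ ^ 2 from Real.rpow_two _, mul_comm]

omit [Fintype ι] [DecidableEq ι] in
/-- Rotation invariance of Lebesgue measure on `ℂ`: `∫ g(ω z) dz = ∫ g(z) dz` for `|ω| = 1`. [folklore] -/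
theorem integral_comp_circle_mul {E : Type*} [NormedAddCommGroup E] [NormedSpace ℝ E]
    (ω : Circle) (g : ℂ → E) : ∫ z : ℂ, g ((ω : ℂ) * z) = ∫ z, g z := by
  have hmp : MeasurePreserving (rotation ω) volume volume := (rotation ω).measurePreserving
  exact hmp.integral_comp (rotation ω).toHomeomorph.measurableEmbedding g

omit [Fintype ι] [DecidableEq ι] in
/-- **Gaussian moments in one complex variable**: `∫_ℂ e^{-|z|²} conj(z)^m zⁿ dA = π m!` if
`m = n` and `0` otherwise (phase rotation kills `m ≠ n`; `|z|^{2n}` against `e^{-|z|²}` gives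
`π n!`). [folklore] -/
theorem integral_gauss_conj_pow_mul_pow (m n : ℕ) :
    ∫ z : ℂ, (Real.exp (-‖z‖ ^ 2) : ℂ) * (conj z ^ m * z ^ n) =
      if m = n then (((Real.pi * m.factorial : ℝ)) : ℂ) else 0 := by
  by_cases hmn : m = n
  · subst hmn
    rw [if_pos rfl, ← integral_exp_neg_norm_sq_mul_norm_pow m, ← integral_complex_ofReal]
    refine integral_congr_ae (Filter.Eventually.of_forall fun z => ?_)
    simp only
    rw [← mul_pow, Complex.conj_mul', ← pow_mul]
    push_cast
    ring
  · rw [if_neg hmn]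
    -- rotate the phase by `ω = e^{iπ/k}`, `k = |n - m| > 0`
    set k : ℕ := if m < n then n - m else m - n with hk_def
    have hk : 0 < k := by
      rw [hk_def]; split_ifs with h
      · exact Nat.sub_pos_of_lt h
      · exact Nat.sub_pos_of_lt (lt_of_le_of_ne (not_lt.1 h) (Ne.symm hmn))
    set ω : Circle := Circle.exp (Real.pi / k) with hω_def
    have hωk : (ω : ℂ) ^ k = -1 := by
      have hkC : (k : ℂ) ≠ 0 := by exact_mod_cast hk.ne'
      rw [hω_def, Circle.coe_exp, ← Complex.exp_nat_mul, Complex.ofReal_div, Complex.ofReal_natCast]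
      rw [show (k : ℂ) * (Real.pi / k * Complex.I) = Real.pi * Complex.I by field_simp]
      exact Complex.exp_pi_mul_I
    have hω0 : (ω : ℂ) ≠ 0 := Circle.coe_ne_zero ω
    -- the phase factor `λ = conj(ω)^m ω^n = -1`
    have hlam : conj (ω : ℂ) ^ m * (ω : ℂ) ^ n = -1 := by
      rw [← Circle.coe_inv_eq_conj, Circle.coe_inv, inv_pow]
      rw [hk_def] at hωk
      split_ifs at hωk with h
      · -- n = m + (n - m)
        have hn : n = m + (n - m) := by omega
        conv_lhs => rw [hn, pow_add]
        rw [← mul_assoc, inv_mul_cancel₀ (pow_ne_zero m hω0), one_mul, hωk]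
      · have hm : m = n + (m - n) := by omega
        conv_lhs => rw [hm, pow_add, mul_inv]
        rw [mul_assoc, mul_comm ((ω : ℂ) ^ (m - n))⁻¹, ← mul_assoc,
          inv_mul_cancel₀ (pow_ne_zero n hω0), one_mul, hωk, inv_neg, inv_one]
    set g : ℂ → ℂ := fun z => (Real.exp (-‖z‖ ^ 2) : ℂ) * (conj z ^ m * z ^ n) with hg_def
    have hpt : ∀ z : ℂ, g ((ω : ℂ) * z) = (conj (ω : ℂ) ^ m * (ω : ℂ) ^ n) * g z := by
      intro z
      simp only [hg_def, norm_mul, Circle.norm_coe, one_mul, map_mul, mul_pow]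
      ring
    have key : ∫ z, g ((ω : ℂ) * z) = ∫ z, g z := integral_comp_circle_mul ω g
    simp_rw [hpt, hlam] at key
    rw [integral_const_mul, neg_one_mul] at key
    exact add_self_eq_zero.1 (neg_eq_iff_add_eq_zero.1 key)

/-! ### Occupation numbers and regrouping of monomials -/

omit [Fintype ι] in
/-- Regrouping a product over `j` by the value of `f j`:
`∏ⱼ h(f j) = ∏ᵢ h(i)^{#{j | f j = i}}`. [folklore] -/
theorem prod_apply_eq_prod_pow_card [Fintype ι] {M : Type*} [CommMonoid M] {m : ℕ}
    (h : ι → M) (f : Fin m → ι) :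
    ∏ j, h (f j) = ∏ i, h i ^ (Finset.univ.filter fun j => f j = i).card := by
  rw [← Finset.prod_fiberwise' Finset.univ f h]
  refine Finset.prod_congr rfl fun i _ => ?_
  rw [Finset.prod_const]

omit [DecidableEq ι] in
/-- The Gaussian weight factorises: `e^{-q(c)} = ∏ᵢ e^{-‖cᵢ‖²}` (as complex numbers). [folklore] -/
theorem gauss_eq_prod (c : ι → ℂ) :
    ((Real.exp (-(∑ i, ‖c i‖ ^ 2)) : ℝ) : ℂ) = ∏ i, ((Real.exp (-‖c i‖ ^ 2) : ℝ) : ℂ) := by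
  rw [← Complex.ofReal_prod, ← Real.exp_sum, Finset.sum_neg_distrib]

/-- **Orthogonality of Gaussian monomials (Bargmann).** For `f g : Fin m → ι`,
`∫ e^{-q(c)} (∏ⱼ conj c_{f j}) (∏ⱼ c_{g j}) dc = π^{|ι|} ∏ᵢ αᵢ(f)!` if the occupation numbers
`αᵢ(f) = #{j | f j = i}` of `f` and `g` agree, and `0` otherwise (Fubini over the coordinates and
the one-variable moments). [folklore] -/
theorem integral_gauss_prod_conj_mul_prod {m : ℕ} (f g : Fin m → ι) :
    ∫ c : ι → ℂ, (Real.exp (-(∑ i, ‖c i‖ ^ 2)) : ℂ) * ((∏ j, conj (c (f j))) * ∏ j, c (g j)) =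
      if (fun i => (Finset.univ.filter fun j => f j = i).card) =
          fun i => (Finset.univ.filter fun j => g j = i).card then
        (((Real.pi ^ Fintype.card ι *
          ∏ i, ((Finset.univ.filter fun j => f j = i).card.factorial : ℝ) : ℝ)) : ℂ)
      else 0 := by
  set a : ι → ℕ := fun i => (Finset.univ.filter fun j => f j = i).card with ha_def
  set b : ι → ℕ := fun i => (Finset.univ.filter fun j => g j = i).card with hb_def
  -- factorise the integrand over the coordinates
  have hpt : ∀ c : ι → ℂ, (Real.exp (-(∑ i, ‖c i‖ ^ 2)) : ℂ) * ((∏ j, conj (c (f j))) * ∏ j, c (g j)) =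
      ∏ i, ((Real.exp (-‖c i‖ ^ 2) : ℂ) * (conj (c i) ^ a i * c i ^ b i)) := by
    intro c
    rw [gauss_eq_prod, prod_apply_eq_prod_pow_card (fun i => conj (c i)) f,
      prod_apply_eq_prod_pow_card (fun i => c i) g, ← Finset.prod_mul_distrib,
      ← Finset.prod_mul_distrib]
  simp_rw [hpt]
  rw [integral_fintype_prod_volume_eq_prod
    (f := fun i (z : ℂ) => (Real.exp (-‖z‖ ^ 2) : ℂ) * (conj z ^ a i * z ^ b i))]
  simp_rw [integral_gauss_conj_pow_mul_pow]
  by_cases hab : a = b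
  · rw [if_pos hab]
    have : ∀ i, a i = b i := fun i => congr_fun hab i
    simp_rw [if_pos (this _)]
    rw [← Complex.ofReal_prod, Finset.prod_mul_distrib, Finset.prod_const, Finset.card_univ]
  · rw [if_neg hab]
    obtain ⟨i, hi⟩ : ∃ i, a i ≠ b i := Function.ne_iff.1 hab
    exact Finset.prod_eq_zero (Finset.mem_univ i) (if_neg hi)

/-! ### Equal occupation numbers and permutations -/

omit [Fintype ι] in
/-- Occupation numbers are invariant under relabelling: `αᵢ(f ∘ σ) = αᵢ(f)`. [folklore] -/
theorem card_filter_comp_perm {m : ℕ} (f : Fin m → ι) (σ : Equiv.Perm (Fin m)) (i : ι) :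
    (Finset.univ.filter fun j => f (σ j) = i).card = (Finset.univ.filter fun j => f j = i).card := by
  rw [← Fintype.card_subtype, ← Fintype.card_subtype]
  exact Fintype.card_congr (Equiv.subtypeEquiv σ fun j => Iff.rfl)

omit [Fintype ι] in
/-- **Equal occupation numbers come from a permutation**: if `#{j | f j = i} = #{j | g j = i}`
for every `i`, then `g = f ∘ σ` for some `σ ∈ S_m` (glue bijections between the fibres). [folklore] -/
theorem exists_perm_comp_eq_of_occ_eq {m : ℕ} {f g : Fin m → ι}
    (h : ∀ i, (Finset.univ.filter fun j => f j = i).card = (Finset.univ.filter fun j => g j = i).card) :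
    ∃ σ : Equiv.Perm (Fin m), f ∘ σ = g := by
  have hcard : ∀ i, Fintype.card {j // g j = i} = Fintype.card {j // f j = i} := fun i => by
    rw [Fintype.card_subtype, Fintype.card_subtype, h i]
  let e : ∀ i, {j // g j = i} ≃ {j // f j = i} := fun i => Fintype.equivOfCardEq (hcard i)
  refine ⟨(Equiv.sigmaFiberEquiv g).symm.trans ((Equiv.sigmaCongrRight e).trans
    (Equiv.sigmaFiberEquiv f)), funext fun j => ?_⟩
  simp only [Function.comp_apply, Equiv.trans_apply, Equiv.sigmaCongrRight_apply,
    Equiv.sigmaFiberEquiv_apply]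
  exact (e (g j) ⟨j, rfl⟩).property

/-- The number of permutations `σ` with `f ∘ σ = f ∘ σ₀` is `∏ᵢ αᵢ(f)!` (translate by `σ₀`, then
Mathlib's `DomMulAct.stabilizer_card`). [folklore] -/
theorem card_perm_comp_eq {m : ℕ} (f : Fin m → ι) (σ₀ : Equiv.Perm (Fin m)) :
    (Finset.univ.filter fun σ : Equiv.Perm (Fin m) => f ∘ ⇑σ = f ∘ ⇑σ₀).card =
      ∏ i, ((Finset.univ.filter fun j => f j = i).card).factorial := by
  rw [← Fintype.card_subtype]
  have h1 : Fintype.card {σ : Equiv.Perm (Fin m) // f ∘ ⇑σ = f ∘ ⇑σ₀} =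
      Fintype.card {ρ : Equiv.Perm (Fin m) // (f ∘ ⇑σ₀) ∘ ⇑ρ = f ∘ ⇑σ₀} := by
    refine Fintype.card_congr ((Equiv.subtypeEquiv (Equiv.mulLeft σ₀) fun ρ => ?_).symm)
    simp only [Equiv.coe_mulLeft, Equiv.Perm.coe_mul, Function.comp_assoc]
  rw [h1, DomMulAct.stabilizer_card (f ∘ ⇑σ₀)]
  refine Finset.prod_congr rfl fun i _ => ?_
  rw [Fintype.card_subtype]
  exact congr_arg _ (card_filter_comp_perm f σ₀ i)

/-- The orbit of `f` under relabelling is the set of maps with the same occupation numbers. [folklore] -/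
theorem image_comp_perm_eq_filter {m : ℕ} (f : Fin m → ι) :
    Finset.univ.image (fun σ : Equiv.Perm (Fin m) => f ∘ ⇑σ) =
      Finset.univ.filter fun g : Fin m → ι =>
        (fun i => (Finset.univ.filter fun j => g j = i).card) =
          fun i => (Finset.univ.filter fun j => f j = i).card := by
  ext g
  simp only [Finset.mem_image, Finset.mem_univ, true_and, Finset.mem_filter]
  constructor
  · rintro ⟨σ, rfl⟩
    funext i
    exact card_filter_comp_perm f σ i
  · intro hg
    obtain ⟨σ, hσ⟩ := exists_perm_comp_eq_of_occ_eq (f := f) (g := g) fun i => (congr_fun hg i).symm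
    exact ⟨σ, hσ⟩

/-- **Orbit sum.** `∑_{σ ∈ S_m} G(f ∘ σ) = (∏ᵢ αᵢ(f)!) · ∑_{g : α(g) = α(f)} G(g)`: every map with
the occupation numbers of `f` is hit exactly `|Stab(f)| = ∏ᵢ αᵢ(f)!` times. [folklore] -/
theorem sum_perm_comp {m : ℕ} (f : Fin m → ι) (G : (Fin m → ι) → ℂ) :
    ∑ σ : Equiv.Perm (Fin m), G (f ∘ ⇑σ) =
      (∏ i, (((Finset.univ.filter fun j => f j = i).card).factorial : ℂ)) *
        ∑ g ∈ Finset.univ.filter (fun g : Fin m → ι =>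
          (fun i => (Finset.univ.filter fun j => g j = i).card) =
            fun i => (Finset.univ.filter fun j => f j = i).card), G g := by
  rw [Finset.sum_comp, ← image_comp_perm_eq_filter, Finset.mul_sum]
  refine Finset.sum_congr rfl fun g hg => ?_
  obtain ⟨σ₀, -, rfl⟩ := Finset.mem_image.1 hg
  rw [card_perm_comp_eq f σ₀, nsmul_eq_mul]
  push_cast
  rfl

/-- **Symmetric coefficients against the pairing matrix.** If `A (f ∘ σ) = A f` for all
`σ ∈ S_m`, then `∑_g conj(A g) ∫ e^{-q} conj(c)^f c^g dc = π^{|ι|} m! conj(A f)`. [folklore] -/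
theorem sum_conj_mul_pairing {m : ℕ} (A : (Fin m → ι) → ℂ)
    (hA : ∀ (σ : Equiv.Perm (Fin m)) (f : Fin m → ι), A (f ∘ ⇑σ) = A f) (f : Fin m → ι) :
    ∑ g : Fin m → ι, conj (A g) *
        ∫ c : ι → ℂ, (Real.exp (-(∑ i, ‖c i‖ ^ 2)) : ℂ) * ((∏ j, conj (c (f j))) * ∏ j, c (g j)) =
      (((Real.pi ^ Fintype.card ι * m.factorial : ℝ)) : ℂ) * conj (A f) := by
  simp_rw [integral_gauss_prod_conj_mul_prod, mul_ite, mul_zero]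
  rw [← Finset.sum_filter]
  -- the filter is over `g` with `α(f) = α(g)`; rewrite to `α(g) = α(f)`
  have hfilt : (Finset.univ.filter fun g : Fin m → ι =>
      (fun i => (Finset.univ.filter fun j => f j = i).card) =
        fun i => (Finset.univ.filter fun j => g j = i).card) =
      Finset.univ.filter fun g : Fin m → ι =>
        (fun i => (Finset.univ.filter fun j => g j = i).card) =
          fun i => (Finset.univ.filter fun j => f j = i).card := by
    ext g; simp only [Finset.mem_filter, Finset.mem_univ, true_and]; exact eq_comm
  rw [hfilt, ← Finset.sum_mul, mul_comm]
  -- `∑_{α(g)=α(f)} conj(A g) · ∏ αᵢ(f)! = ∑_σ conj(A (f∘σ)) = m! conj(A f)`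
  have hsum := sum_perm_comp f (fun g => conj (A g))
  simp only [hA] at hsum
  rw [Finset.sum_const, Finset.card_univ, Fintype.card_perm, Fintype.card_fin, nsmul_eq_mul] at hsum
  -- hsum : m! * conj(A f) = (∏ αᵢ(f)!) * ∑_{filter} conj(A g)
  push_cast
  rw [mul_assoc, ← hsum]
  ring

end Summit.AtomisticToContinuum.BoseEinsteinCondensation.Theorems.BargmannIdentity
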